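import Literature.Analysis.FluidPDE.ElgindiAngularPoincare
import Literature.Analysis.FluidPDE.ElgindiWeightedIBP
import Literature.Analysis.FluidPDE.ElgindiRadialWeightCalculus
import Mathlib.MeasureTheory.Integral.IntervalIntegral.FundThmCalculus
import HarnessLib

/-!
# The mixed derivative `α∂_θD_zΨ` in `𝓗⁴` by interpolation between `∂_θθΨ`, `αD_zΨ`, `α²D_z²Ψ`
([Elgindi2021] §9.2.2 / [ElgindiGhoulMasmoudi2021] §2.3.1, §6 Theorem 3: from the elliptic outputs
to the transport velocity `U(Φ)/sin 2θ = −(3Φ + αD_zΦ)/sin 2θ`)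

Topic `Literature/Analysis/FluidPDE`. Proof file (everything proved, no definitions, no named
facts) on the proof path of the named fact
`Literature.Analysis.FluidPDE.Elgindi.ElgindiGhoulMasmoudi2021_stabilityCore`
(`ElgindiStabilityDecomposition.lean`). T. M. Elgindi, Ann. of Math. 194 (2021) =
arXiv:1904.04795, §9.2.2 (p. 32): "`|U(Φ_g − (4α)⁻¹sin 2θ L₁₂(g))/sin 2θ|_{𝓗⁴} ≤ C|g|_{𝓗⁴}`" needs
`∂_θU = −3∂_θΦ − α∂_θD_zΦ` in `𝓗⁴` (Proposition 8.21), while Theorem 2 (p. 24) and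
Elgindi–Ghoul–Masmoudi's Theorem 3 (arXiv:1910.14071, §6, p. 15) export `∂_θθΦ`, `αD_RΦ`, `α²D_R²Φ`:
the mixed derivative is recovered here by a weighted interpolation.

This file, part 1 (the angular identity): for `Z ∈ C^∞(ℝ)` with `Z(0) = Z(π/2) = 0`,
`∫ Z′²S^{−η} ≤ 199·(−∫ ZZ″S^{−η})` (`wsq_neg_eta_deriv_le_neg_integral`; `S = sin 2θ`, `η = 99/100`):
the boundary function `G = ZZ′S^{−η} − η cos 2θ·Z²S^{−η−1}` gives
`X = N + 4ηJ − 2ηP − 2η(1+η)Q` (`X = ∫Z′²S^{−η}`, `N = −∫ZZ″S^{−η}`, `J = ∫cos 2θ ZZ′S^{−η−1}`,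
`P = ∫Z²S^{−η}`, `Q = ∫cos²2θ Z²S^{−η−2}`), Cauchy–Schwarz `J² ≤ XQ` and `4ηJ ≤ (2η/(1+η))X + 2η(1+η)Q`
leave `((1−η)/(1+η))X + 2ηP ≤ N`. [folklore] (weighted interpolation); the cites record its role.
-/

noncomputable section

open Set Real MeasureTheory Finset Function intervalIntegral Filter
open _root_.Topology
open scoped ContDiff ENNReal

namespace Literature.Analysis.FluidPDE

namespace Elgindi

/-! ### The algebra of the absorption -/

/-- From `X = N + 4ηJ − 2ηP − 2η(1+η)Q`, `J² ≤ XQ`, `X, P, Q ≥ 0` (`η = 99/100`): `X ≤ 199N`. [folklore] -/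
theorem interp_absorb {X N J P Q : ℝ} (hX : 0 ≤ X) (hP : 0 ≤ P) (hQ : 0 ≤ Q) (hJ : J ^ 2 ≤ X * Q)
    (hid : X = N + 4 * eta * J - 2 * eta * P - 2 * eta * (1 + eta) * Q) : X ≤ 199 * N := by
  have hη : eta = 99 / 100 := rfl
  -- `4ηJ ≤ (2η/(1+η))X + 2η(1+η)Q`
  have hkey : 4 * eta * J ≤ 2 * eta / (1 + eta) * X + 2 * eta * (1 + eta) * Q := by
    rw [hη]
    rcases hQ.lt_or_eq with hQpos | hQ0
    · -- `Q·((1+η)²Q − 2(1+η)J + X) = ((1+η)Q − J)² + (XQ − J²) ≥ 0`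
      have h2 : Q * ((199 / 100) ^ 2 * Q - 2 * (199 / 100) * J + X) = ((199 / 100) * Q - J) ^ 2 + (X * Q - J ^ 2) := by ring
      have h3 : 0 ≤ Q * ((199 / 100) ^ 2 * Q - 2 * (199 / 100) * J + X) := by rw [h2]; nlinarith [sq_nonneg ((199 / 100) * Q - J)]
      have h1 : 0 ≤ (199 / 100) ^ 2 * Q - 2 * (199 / 100) * J + X := (mul_nonneg_iff_of_pos_left hQpos).mp h3
      nlinarith
    · have hJ0 : J = 0 := by
        have : J ^ 2 ≤ 0 := by rw [← hQ0, mul_zero] at hJ; exact hJ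
        nlinarith [sq_nonneg J]
      rw [hJ0, ← hQ0]; nlinarith
  rw [hη] at hkey hid
  nlinarith

/-! ### The angular identity for one slice -/

/-- A uniform bound for a continuous function on `[0, π/2]`, read on `(0, π/2)`. [folklore] -/
private theorem exists_bound_Ioo {g : ℝ → ℝ} (hg : Continuous g) : ∃ M, 0 ≤ M ∧ ∀ θ ∈ Ioo (0:ℝ) (π / 2), |g θ| ≤ M := by
  obtain ⟨M, hM⟩ := isCompact_Icc.exists_bound_of_continuousOn (s := Icc (0:ℝ) (π / 2)) hg.continuousOn
  have hb : (0:ℝ) < π / 2 := by positivity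
  refine ⟨M, (norm_nonneg _).trans (hM 0 ⟨le_rfl, hb.le⟩), fun θ hθ => ?_⟩
  have := hM θ (Ioo_subset_Icc_self hθ); rwa [Real.norm_eq_abs] at this

set_option maxHeartbeats 1600000 in
/-- **The angular interpolation inequality** for `Z ∈ C^∞(ℝ)` with `Z(0) = Z(π/2) = 0`:
`∫_{(0,π/2)} Z′²S^{−η} ≤ 199·(−∫_{(0,π/2)} Z·Z″·S^{−η})` (`S = sin 2θ`, `η = 99/100`), and the
integrand `ZZ″S^{−η}` is integrable. [folklore] -/
theorem wsq_neg_eta_deriv_le_neg_integral {Z : ℝ → ℝ} (hZ : ContDiff ℝ ∞ Z) (h0 : Z 0 = 0) (h1 : Z (π / 2) = 0) :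
    IntegrableOn (fun θ => Z θ * deriv (deriv Z) θ * Real.sin (2 * θ) ^ (-eta)) (Ioo 0 (π / 2)) ∧
    wsq (-eta) (deriv Z) ≤ 199 * -∫ θ in Ioo 0 (π / 2), Z θ * deriv (deriv Z) θ * Real.sin (2 * θ) ^ (-eta) := by
  have hη : eta = 99 / 100 := rfl
  have hη0 : (0:ℝ) ≤ eta := eta_pos.le
  have hη1 : eta < 1 := by norm_num [eta]
  have hb : (0 : ℝ) < π / 2 := by positivity
  set η := eta with hηdef
  have h1η : (1:ℝ) - η ≠ 0 := by rw [hη]; norm_num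
  have h1ηpos : (0:ℝ) ≤ 1 - η := by rw [hη]; norm_num
  have hneg1 : (-1:ℝ) < -η := by rw [hη]; norm_num
  have hneg0 : -η ≤ (0:ℝ) := by rw [hη]; norm_num
  -- regularity and bounds
  have hZ1 : ContDiff ℝ 1 Z := hZ.of_le ENat.LEInfty.out
  have hZc : Continuous Z := hZ.continuous
  have hdZ : ContDiff ℝ ∞ (deriv Z) := hZ.deriv'
  have hdZc : Continuous (deriv Z) := hdZ.continuous
  have hddZ : ContDiff ℝ ∞ (deriv (deriv Z)) := hdZ.deriv'
  have hddZc : Continuous (deriv (deriv Z)) := hddZ.continuous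
  have hd : ∀ θ, HasDerivAt Z (deriv Z θ) θ := fun θ => ((hZ.differentiable (by simp)) θ).hasDerivAt
  have hdd : ∀ θ, HasDerivAt (deriv Z) (deriv (deriv Z) θ) θ := fun θ => ((hdZ.differentiable (by simp)) θ).hasDerivAt
  obtain ⟨K, hK0, hK⟩ := exists_abs_le_mul_sin_two_mul hZ1 h0 h1
  obtain ⟨M, hM0, hM⟩ := exists_bound_Ioo hdZc
  obtain ⟨M₂, hM₂0, hM₂⟩ := exists_bound_Ioo hddZc
  have hsin : ∀ θ ∈ Ioo 0 (π / 2), 0 < Real.sin (2 * θ) := fun θ hθ => sin_two_mul_pos_of_mem hθ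
  -- the boundary function and its derivative
  set G : ℝ → ℝ := fun θ => Z θ * deriv Z θ * Real.sin (2 * θ) ^ (-η) -
    η * Real.cos (2 * θ) * Z θ ^ 2 * (Real.sin (2 * θ))⁻¹ * Real.sin (2 * θ) ^ (-η) with hG
  set G' : ℝ → ℝ := fun θ => deriv Z θ ^ 2 * Real.sin (2 * θ) ^ (-η) + Z θ * deriv (deriv Z) θ * Real.sin (2 * θ) ^ (-η) -
    4 * η * Real.cos (2 * θ) * Z θ * deriv Z θ * Real.sin (2 * θ) ^ (-η) * (Real.sin (2 * θ))⁻¹ +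
    2 * η * Z θ ^ 2 * Real.sin (2 * θ) ^ (-η) +
    2 * η * (1 + η) * Real.cos (2 * θ) ^ 2 * Z θ ^ 2 * Real.sin (2 * θ) ^ (-η) * (Real.sin (2 * θ))⁻¹ ^ 2 with hG'
  have hderiv : ∀ θ ∈ Ioo 0 (π / 2), HasDerivAt G (G' θ) θ := by
    intro θ hθ
    have hs := hsin θ hθ
    have hsne : Real.sin (2 * θ) ≠ 0 := hs.ne'
    have h2 : HasDerivAt (fun x : ℝ => 2 * x) 2 θ := by simpa using (hasDerivAt_id' θ).const_mul (2 : ℝ)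
    have hS : HasDerivAt (fun x => Real.sin (2 * x)) (Real.cos (2 * θ) * 2) θ := h2.sin
    have hC : HasDerivAt (fun x => Real.cos (2 * x)) (-Real.sin (2 * θ) * 2) θ := h2.cos
    have hU : HasDerivAt (fun x => Real.sin (2 * x) ^ (-η)) (Real.cos (2 * θ) * 2 * (-η) * Real.sin (2 * θ) ^ (-η - 1)) θ :=
      hS.rpow_const (Or.inl hsne)
    have hI : HasDerivAt (fun x => (Real.sin (2 * x))⁻¹) (-(Real.cos (2 * θ) * 2) / Real.sin (2 * θ) ^ 2) θ := hS.fun_inv hsne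
    have e2 : (fun y => Z y ^ 2) = fun y => Z y * Z y := by funext y; ring
    have hP : HasDerivAt (fun y => Z y ^ 2) (2 * Z θ * deriv Z θ) θ := by
      rw [e2]; exact ((hd θ).mul (hd θ)).congr_deriv (by ring)
    have hPQ : HasDerivAt (fun y => Z y * deriv Z y) (deriv Z θ * deriv Z θ + Z θ * deriv (deriv Z) θ) θ := (hd θ).mul (hdd θ)
    have hU' : HasDerivAt (fun x => Real.sin (2 * x) ^ (-η)) (-2 * η * Real.cos (2 * θ) * (Real.sin (2 * θ))⁻¹ * Real.sin (2 * θ) ^ (-η)) θ := by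
      refine hU.congr_deriv ?_
      rw [Real.rpow_sub_one hsne]; field_simp
    have hI' : HasDerivAt (fun x => (Real.sin (2 * x))⁻¹) (-2 * Real.cos (2 * θ) * (Real.sin (2 * θ))⁻¹ ^ 2) θ := by
      refine hI.congr_deriv ?_
      field_simp
    have hA := hPQ.mul hU'
    have hB := ((((hC.const_mul η).mul hP).mul hI').mul hU')
    have hall := hA.sub hB
    refine hall.congr_deriv ?_
    have hSS : Real.sin (2 * θ) * (Real.sin (2 * θ))⁻¹ = 1 := mul_inv_cancel₀ hsne
    simp only [hG', Pi.mul_apply]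
    linear_combination (2 * η * Z θ ^ 2 * Real.sin (2 * θ) ^ (-η)) * hSS
  -- `|G| ≤ (KM + ηK²)·S^{1−η}`
  have hGabs : ∀ θ ∈ Ioo 0 (π / 2), |G θ| ≤ (K * M + η * K ^ 2) * Real.sin (2 * θ) ^ (1 - η) := by
    intro θ hθ
    have hs := hsin θ hθ
    have hu : 0 ≤ Real.sin (2 * θ) ^ (-η) := Real.rpow_nonneg hs.le _
    have e : Real.sin (2 * θ) ^ (1 - η) = Real.sin (2 * θ) * Real.sin (2 * θ) ^ (-η) := by
      rw [sub_eq_add_neg, Real.rpow_add hs, Real.rpow_one]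
    have hp := hK θ (Ioo_subset_Icc_self hθ)
    have hq := hM θ hθ
    have hc := Real.abs_cos_le_one (2 * θ)
    have t1 : |Z θ * deriv Z θ * Real.sin (2 * θ) ^ (-η)| ≤ K * M * (Real.sin (2 * θ) * Real.sin (2 * θ) ^ (-η)) := by
      rw [abs_mul, abs_mul, abs_of_nonneg hu]
      have h3 : |Z θ| * |deriv Z θ| ≤ K * Real.sin (2 * θ) * M := mul_le_mul hp hq (abs_nonneg _) (by positivity)
      have h4 := mul_le_mul_of_nonneg_right h3 hu
      linarith
    have t2 : |η * Real.cos (2 * θ) * Z θ ^ 2 * (Real.sin (2 * θ))⁻¹ * Real.sin (2 * θ) ^ (-η)| ≤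
        η * K ^ 2 * (Real.sin (2 * θ) * Real.sin (2 * θ) ^ (-η)) := by
      rw [abs_mul, abs_mul, abs_mul, abs_mul, abs_of_nonneg hη0, abs_of_nonneg hu, abs_inv, abs_of_pos hs, abs_pow]
      have hp2 : |Z θ| ^ 2 ≤ (K * Real.sin (2 * θ)) ^ 2 := pow_le_pow_left₀ (abs_nonneg _) hp 2
      have h3 : |Z θ| ^ 2 * (Real.sin (2 * θ))⁻¹ ≤ K ^ 2 * Real.sin (2 * θ) := by
        rw [← div_eq_mul_inv, div_le_iff₀ hs]; nlinarith
      calc η * |Real.cos (2 * θ)| * |Z θ| ^ 2 * (Real.sin (2 * θ))⁻¹ * Real.sin (2 * θ) ^ (-η)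
          = η * (|Real.cos (2 * θ)| * (|Z θ| ^ 2 * (Real.sin (2 * θ))⁻¹)) * Real.sin (2 * θ) ^ (-η) := by ring
        _ ≤ η * (1 * (K ^ 2 * Real.sin (2 * θ))) * Real.sin (2 * θ) ^ (-η) :=
            mul_le_mul_of_nonneg_right (mul_le_mul_of_nonneg_left
              (mul_le_mul hc h3 (mul_nonneg (sq_nonneg _) (inv_pos.2 hs).le) zero_le_one) hη0) hu
        _ = _ := by ring
    rw [e]
    calc |G θ| ≤ |Z θ * deriv Z θ * Real.sin (2 * θ) ^ (-η)| + |η * Real.cos (2 * θ) * Z θ ^ 2 * (Real.sin (2 * θ))⁻¹ * Real.sin (2 * θ) ^ (-η)| :=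
          abs_sub _ _
      _ ≤ _ := by nlinarith [t1, t2]
  -- `|G'| ≤ L·S^{−η}`
  set L : ℝ := M ^ 2 + K * M₂ + 4 * η * K * M + 2 * η * K ^ 2 + 2 * η * (1 + η) * K ^ 2 with hL
  have hG'abs : ∀ θ ∈ Ioo 0 (π / 2), |G' θ| ≤ L * Real.sin (2 * θ) ^ (-η) := by
    intro θ hθ
    have hs := hsin θ hθ
    have hs1 : Real.sin (2 * θ) ≤ 1 := Real.sin_le_one _
    have hu : 0 ≤ Real.sin (2 * θ) ^ (-η) := Real.rpow_nonneg hs.le _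
    have hp := hK θ (Ioo_subset_Icc_self hθ)
    have hq := hM θ hθ
    have hr := hM₂ θ hθ
    have hc := Real.abs_cos_le_one (2 * θ)
    have hpS : |Z θ| * (Real.sin (2 * θ))⁻¹ ≤ K := by rw [← div_eq_mul_inv, div_le_iff₀ hs]; exact hp
    have hpK : |Z θ| ≤ K := hp.trans (by nlinarith)
    -- termwise
    have u1 : |deriv Z θ ^ 2 * Real.sin (2 * θ) ^ (-η)| ≤ M ^ 2 * Real.sin (2 * θ) ^ (-η) := by
      rw [abs_mul, abs_of_nonneg hu, abs_pow]; gcongr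
    have u2 : |Z θ * deriv (deriv Z) θ * Real.sin (2 * θ) ^ (-η)| ≤ K * M₂ * Real.sin (2 * θ) ^ (-η) := by
      rw [abs_mul, abs_mul, abs_of_nonneg hu]; gcongr
    have u3 : |4 * η * Real.cos (2 * θ) * Z θ * deriv Z θ * Real.sin (2 * θ) ^ (-η) * (Real.sin (2 * θ))⁻¹| ≤
        4 * η * K * M * Real.sin (2 * θ) ^ (-η) := by
      have e : 4 * η * Real.cos (2 * θ) * Z θ * deriv Z θ * Real.sin (2 * θ) ^ (-η) * (Real.sin (2 * θ))⁻¹ =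
          4 * η * (Real.cos (2 * θ) * ((Z θ * (Real.sin (2 * θ))⁻¹) * deriv Z θ)) * Real.sin (2 * θ) ^ (-η) := by ring
      rw [e]
      simp only [abs_mul, abs_inv, abs_of_pos hs, abs_of_nonneg hu, abs_of_nonneg hη0, abs_of_nonneg (show (0:ℝ) ≤ 4 by norm_num)]
      have h4 : |Real.cos (2 * θ)| * (|Z θ| * (Real.sin (2 * θ))⁻¹ * |deriv Z θ|) ≤ K * M := by
        have := mul_le_mul hc (mul_le_mul hpS hq (abs_nonneg _) hK0) (by positivity) zero_le_one
        linarith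
      calc 4 * η * (|Real.cos (2 * θ)| * (|Z θ| * (Real.sin (2 * θ))⁻¹ * |deriv Z θ|)) * Real.sin (2 * θ) ^ (-η)
          ≤ 4 * η * (K * M) * Real.sin (2 * θ) ^ (-η) := by gcongr
        _ = _ := by ring
    have u4 : |2 * η * Z θ ^ 2 * Real.sin (2 * θ) ^ (-η)| ≤ 2 * η * K ^ 2 * Real.sin (2 * θ) ^ (-η) := by
      rw [abs_mul, abs_of_nonneg hu, abs_mul, abs_pow, abs_mul, abs_of_nonneg (by norm_num : (0:ℝ) ≤ 2), abs_of_nonneg hη0]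
      gcongr
    have u5 : |2 * η * (1 + η) * Real.cos (2 * θ) ^ 2 * Z θ ^ 2 * Real.sin (2 * θ) ^ (-η) * (Real.sin (2 * θ))⁻¹ ^ 2| ≤
        2 * η * (1 + η) * K ^ 2 * Real.sin (2 * θ) ^ (-η) := by
      have e : 2 * η * (1 + η) * Real.cos (2 * θ) ^ 2 * Z θ ^ 2 * Real.sin (2 * θ) ^ (-η) * (Real.sin (2 * θ))⁻¹ ^ 2 =
          2 * η * (1 + η) * (Real.cos (2 * θ) ^ 2 * (Z θ * (Real.sin (2 * θ))⁻¹) ^ 2) * Real.sin (2 * θ) ^ (-η) := by ring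
      have h1η : (0:ℝ) ≤ 1 + η := by positivity
      rw [e]
      simp only [abs_mul, abs_pow, abs_inv, abs_of_pos hs, abs_of_nonneg hu, abs_of_nonneg hη0, abs_of_nonneg h1η,
        abs_of_nonneg (show (0:ℝ) ≤ 2 by norm_num)]
      have hc2 : |Real.cos (2 * θ)| ^ 2 ≤ 1 := by nlinarith [abs_nonneg (Real.cos (2 * θ))]
      have hk2 : (|Z θ| * (Real.sin (2 * θ))⁻¹) ^ 2 ≤ K ^ 2 := pow_le_pow_left₀ (by positivity) hpS 2
      have h5 : |Real.cos (2 * θ)| ^ 2 * (|Z θ| * (Real.sin (2 * θ))⁻¹) ^ 2 ≤ K ^ 2 := by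
        have := mul_le_mul hc2 hk2 (by positivity) zero_le_one
        linarith
      exact mul_le_mul_of_nonneg_right (mul_le_mul_of_nonneg_left h5 (by positivity : (0:ℝ) ≤ 2 * η * (1 + η))) hu
    simp only [hG', hL]
    calc |deriv Z θ ^ 2 * Real.sin (2 * θ) ^ (-η) + Z θ * deriv (deriv Z) θ * Real.sin (2 * θ) ^ (-η) -
          4 * η * Real.cos (2 * θ) * Z θ * deriv Z θ * Real.sin (2 * θ) ^ (-η) * (Real.sin (2 * θ))⁻¹ +
          2 * η * Z θ ^ 2 * Real.sin (2 * θ) ^ (-η) +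
          2 * η * (1 + η) * Real.cos (2 * θ) ^ 2 * Z θ ^ 2 * Real.sin (2 * θ) ^ (-η) * (Real.sin (2 * θ))⁻¹ ^ 2|
        ≤ |deriv Z θ ^ 2 * Real.sin (2 * θ) ^ (-η)| + |Z θ * deriv (deriv Z) θ * Real.sin (2 * θ) ^ (-η)| +
          |4 * η * Real.cos (2 * θ) * Z θ * deriv Z θ * Real.sin (2 * θ) ^ (-η) * (Real.sin (2 * θ))⁻¹| +
          |2 * η * Z θ ^ 2 * Real.sin (2 * θ) ^ (-η)| +
          |2 * η * (1 + η) * Real.cos (2 * θ) ^ 2 * Z θ ^ 2 * Real.sin (2 * θ) ^ (-η) * (Real.sin (2 * θ))⁻¹ ^ 2| := by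
          set A := deriv Z θ ^ 2 * Real.sin (2 * θ) ^ (-η)
          set B := Z θ * deriv (deriv Z) θ * Real.sin (2 * θ) ^ (-η)
          set C := 4 * η * Real.cos (2 * θ) * Z θ * deriv Z θ * Real.sin (2 * θ) ^ (-η) * (Real.sin (2 * θ))⁻¹
          set D := 2 * η * Z θ ^ 2 * Real.sin (2 * θ) ^ (-η)
          set E := 2 * η * (1 + η) * Real.cos (2 * θ) ^ 2 * Z θ ^ 2 * Real.sin (2 * θ) ^ (-η) * (Real.sin (2 * θ))⁻¹ ^ 2
          have t1 := abs_add_le (A + B - C + D) E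
          have t2 := abs_add_le (A + B - C) D
          have t3 := abs_sub (A + B) C
          have t4 := abs_add_le A B
          linarith
      _ ≤ _ := by nlinarith [u1, u2, u3, u4, u5]
  -- limits of `G` at the endpoints
  have hg : Continuous fun θ : ℝ => (K * M + η * K ^ 2) * Real.sin (2 * θ) ^ (1 - η) :=
    continuous_const.mul ((by fun_prop : Continuous fun θ : ℝ => Real.sin (2 * θ)).rpow_const fun _ => Or.inr h1ηpos)
  have hg0 : (K * M + η * K ^ 2) * Real.sin (2 * 0) ^ (1 - η) = 0 := by simp [Real.zero_rpow h1η]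
  have hgb : (K * M + η * K ^ 2) * Real.sin (2 * (π / 2)) ^ (1 - η) = 0 := by
    have : Real.sin (2 * (π / 2)) = 0 := by rw [show 2 * (π / 2) = π by ring, Real.sin_pi]
    simp [this, Real.zero_rpow h1η]
  have hlim0 : Tendsto G (𝓝[>] 0) (𝓝 0) := by
    refine squeeze_zero_norm' (a := fun θ => (K * M + η * K ^ 2) * Real.sin (2 * θ) ^ (1 - η)) ?_ ?_
    · filter_upwards [Ioo_mem_nhdsGT hb] with θ hθ
      rw [Real.norm_eq_abs]; exact hGabs θ hθ
    · have := (hg.tendsto 0).mono_left (nhdsWithin_le_nhds (s := Ioi (0 : ℝ)))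
      rwa [hg0] at this
  have hlimb : Tendsto G (𝓝[<] (π / 2)) (𝓝 0) := by
    refine squeeze_zero_norm' (a := fun θ => (K * M + η * K ^ 2) * Real.sin (2 * θ) ^ (1 - η)) ?_ ?_
    · filter_upwards [Ioo_mem_nhdsLT hb] with θ hθ
      rw [Real.norm_eq_abs]; exact hGabs θ hθ
    · have := (hg.tendsto (π / 2)).mono_left (nhdsWithin_le_nhds (s := Iio (π / 2)))
      rwa [hgb] at this
  -- integrability of `G'` and of its five pieces
  have hsm : Measurable fun θ : ℝ => Real.sin (2 * θ) := by fun_prop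
  have hcm : Measurable fun θ : ℝ => Real.cos (2 * θ) := by fun_prop
  have hum : Measurable fun θ : ℝ => Real.sin (2 * θ) ^ (-η) := hsm.pow_const _
  have hZm : Measurable Z := hZc.measurable
  have hdm : Measurable (deriv Z) := hdZc.measurable
  have hddm : Measurable (deriv (deriv Z)) := hddZc.measurable
  have iu := integrableOn_sin_two_mul_rpow (r := -η) hneg1 hneg0
  have dom : ∀ {F : ℝ → ℝ} {c : ℝ}, Measurable F → (∀ θ ∈ Ioo (0:ℝ) (π / 2), |F θ| ≤ c * Real.sin (2 * θ) ^ (-η)) →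
      IntegrableOn F (Ioo 0 (π / 2)) := by
    intro F c hFm hle
    refine Integrable.mono' (iu.const_mul c) hFm.aestronglyMeasurable ?_
    rw [ae_restrict_iff' measurableSet_Ioo]
    exact Filter.Eventually.of_forall fun θ hθ => by rw [Real.norm_eq_abs]; exact hle θ hθ
  have iG' : IntegrableOn G' (Ioo 0 (π / 2)) := dom (by simp only [hG']; fun_prop) hG'abs
  have iX : IntegrableOn (fun θ => deriv Z θ ^ 2 * Real.sin (2 * θ) ^ (-η)) (Ioo 0 (π / 2)) := integrableOn_deriv_sq_mul_rpow hη0 hη1 hZ1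
  have iN : IntegrableOn (fun θ => Z θ * deriv (deriv Z) θ * Real.sin (2 * θ) ^ (-η)) (Ioo 0 (π / 2)) :=
    dom (by fun_prop) fun θ hθ => by
      have hs := hsin θ hθ; have hu : 0 ≤ Real.sin (2 * θ) ^ (-η) := Real.rpow_nonneg hs.le _
      have hpK : |Z θ| ≤ K := (hK θ (Ioo_subset_Icc_self hθ)).trans (by nlinarith [Real.sin_le_one (2 * θ)])
      rw [abs_mul, abs_mul, abs_of_nonneg hu]
      exact mul_le_mul_of_nonneg_right (mul_le_mul hpK (hM₂ θ hθ) (abs_nonneg _) hK0) hu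
  have iJ : IntegrableOn (fun θ => Real.cos (2 * θ) * Z θ * deriv Z θ * Real.sin (2 * θ) ^ (-η) * (Real.sin (2 * θ))⁻¹) (Ioo 0 (π / 2)) :=
    dom (c := K * M) (by fun_prop) fun θ hθ => by
      have hs := hsin θ hθ; have hu : 0 ≤ Real.sin (2 * θ) ^ (-η) := Real.rpow_nonneg hs.le _
      have hpS : |Z θ| * (Real.sin (2 * θ))⁻¹ ≤ K := by rw [← div_eq_mul_inv, div_le_iff₀ hs]; exact hK θ (Ioo_subset_Icc_self hθ)
      have e : Real.cos (2 * θ) * Z θ * deriv Z θ * Real.sin (2 * θ) ^ (-η) * (Real.sin (2 * θ))⁻¹ =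
          Real.cos (2 * θ) * ((Z θ * (Real.sin (2 * θ))⁻¹) * deriv Z θ) * Real.sin (2 * θ) ^ (-η) := by ring
      rw [e]
      simp only [abs_mul, abs_inv, abs_of_pos hs, abs_of_nonneg hu]
      have h4 : |Real.cos (2 * θ)| * (|Z θ| * (Real.sin (2 * θ))⁻¹ * |deriv Z θ|) ≤ K * M := by
        have := mul_le_mul (Real.abs_cos_le_one (2 * θ)) (mul_le_mul hpS (hM θ hθ) (abs_nonneg _) hK0) (by positivity) zero_le_one
        linarith
      gcongr
  have iP : IntegrableOn (fun θ => Z θ ^ 2 * Real.sin (2 * θ) ^ (-η)) (Ioo 0 (π / 2)) := integrableOn_sq_mul_rpow hη0 hη1 hZc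
  have iQ : IntegrableOn (fun θ => Real.cos (2 * θ) ^ 2 * Z θ ^ 2 * Real.sin (2 * θ) ^ (-η) * (Real.sin (2 * θ))⁻¹ ^ 2) (Ioo 0 (π / 2)) :=
    dom (c := K ^ 2) (by fun_prop) fun θ hθ => by
      have hs := hsin θ hθ; have hu : 0 ≤ Real.sin (2 * θ) ^ (-η) := Real.rpow_nonneg hs.le _
      have hpS : |Z θ| * (Real.sin (2 * θ))⁻¹ ≤ K := by rw [← div_eq_mul_inv, div_le_iff₀ hs]; exact hK θ (Ioo_subset_Icc_self hθ)
      have e : Real.cos (2 * θ) ^ 2 * Z θ ^ 2 * Real.sin (2 * θ) ^ (-η) * (Real.sin (2 * θ))⁻¹ ^ 2 =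
          (Real.cos (2 * θ) ^ 2 * (Z θ * (Real.sin (2 * θ))⁻¹) ^ 2) * Real.sin (2 * θ) ^ (-η) := by ring
      rw [e]
      simp only [abs_mul, abs_pow, abs_inv, abs_of_pos hs, abs_of_nonneg hu]
      have hc2 : |Real.cos (2 * θ)| ^ 2 ≤ 1 := by nlinarith [abs_nonneg (Real.cos (2 * θ)), Real.abs_cos_le_one (2 * θ)]
      have hk2 : (|Z θ| * (Real.sin (2 * θ))⁻¹) ^ 2 ≤ K ^ 2 := pow_le_pow_left₀ (by positivity) hpS 2
      have h5 : |Real.cos (2 * θ)| ^ 2 * (|Z θ| * (Real.sin (2 * θ))⁻¹) ^ 2 ≤ K ^ 2 := by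
        have := mul_le_mul hc2 hk2 (by positivity) zero_le_one
        linarith
      gcongr
  -- the identity `∫ G' = 0`
  have hFTC : ∫ θ in Ioo 0 (π / 2), G' θ = 0 := by
    have h := integral_eq_sub_of_hasDerivAt_of_tendsto hb hderiv ((intervalIntegrable_iff_integrableOn_Ioo_of_le hb.le).2 iG') hlim0 hlimb
    rw [intervalIntegral.integral_of_le hb.le, integral_Ioc_eq_integral_Ioo, sub_zero] at h
    exact h
  set X := ∫ θ in Ioo 0 (π / 2), deriv Z θ ^ 2 * Real.sin (2 * θ) ^ (-η) with hX
  set Nn := ∫ θ in Ioo 0 (π / 2), Z θ * deriv (deriv Z) θ * Real.sin (2 * θ) ^ (-η) with hNn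
  set J := ∫ θ in Ioo 0 (π / 2), Real.cos (2 * θ) * Z θ * deriv Z θ * Real.sin (2 * θ) ^ (-η) * (Real.sin (2 * θ))⁻¹ with hJ
  set P := ∫ θ in Ioo 0 (π / 2), Z θ ^ 2 * Real.sin (2 * θ) ^ (-η) with hP
  set Q := ∫ θ in Ioo 0 (π / 2), Real.cos (2 * θ) ^ 2 * Z θ ^ 2 * Real.sin (2 * θ) ^ (-η) * (Real.sin (2 * θ))⁻¹ ^ 2 with hQ
  have hid : X = -Nn + 4 * η * J - 2 * η * P - 2 * η * (1 + η) * Q := by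
    have e : ∫ θ in Ioo 0 (π / 2), G' θ = X + Nn - 4 * η * J + 2 * η * P + 2 * η * (1 + η) * Q := by
      simp only [hG', hX, hNn, hJ, hP, hQ]
      rw [MeasureTheory.integral_add, MeasureTheory.integral_add, MeasureTheory.integral_sub, MeasureTheory.integral_add iX iN]
      · rw [show (fun θ => 4 * η * Real.cos (2 * θ) * Z θ * deriv Z θ * Real.sin (2 * θ) ^ (-η) * (Real.sin (2 * θ))⁻¹) =
            fun θ => 4 * η * (Real.cos (2 * θ) * Z θ * deriv Z θ * Real.sin (2 * θ) ^ (-η) * (Real.sin (2 * θ))⁻¹) by funext θ; ring,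
          show (fun θ => 2 * η * Z θ ^ 2 * Real.sin (2 * θ) ^ (-η)) = fun θ => 2 * η * (Z θ ^ 2 * Real.sin (2 * θ) ^ (-η)) by funext θ; ring,
          show (fun θ => 2 * η * (1 + η) * Real.cos (2 * θ) ^ 2 * Z θ ^ 2 * Real.sin (2 * θ) ^ (-η) * (Real.sin (2 * θ))⁻¹ ^ 2) =
            fun θ => 2 * η * (1 + η) * (Real.cos (2 * θ) ^ 2 * Z θ ^ 2 * Real.sin (2 * θ) ^ (-η) * (Real.sin (2 * θ))⁻¹ ^ 2) by funext θ; ring,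
          MeasureTheory.integral_const_mul, MeasureTheory.integral_const_mul, MeasureTheory.integral_const_mul]
      · exact iX.add iN
      · exact (iJ.const_mul (4 * η)).congr (ae_of_all _ fun θ => by ring)
      · exact ((iX.add iN).sub ((iJ.const_mul (4 * η)).congr (ae_of_all _ fun θ => by ring)))
      · exact (iP.const_mul (2 * η)).congr (ae_of_all _ fun θ => by ring)
      · exact (((iX.add iN).sub ((iJ.const_mul (4 * η)).congr (ae_of_all _ fun θ => by ring))).add
          ((iP.const_mul (2 * η)).congr (ae_of_all _ fun θ => by ring)))
      · exact (iQ.const_mul (2 * η * (1 + η))).congr (ae_of_all _ fun θ => by ring)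
    rw [hFTC] at e
    linarith
  -- Cauchy–Schwarz `J² ≤ XQ`
  have hCS : J ^ 2 ≤ X * Q := by
    set φ : ℝ → ℝ := fun θ => deriv Z θ * Real.sqrt (Real.sin (2 * θ) ^ (-η)) with hφ
    set ψ : ℝ → ℝ := fun θ => Real.cos (2 * θ) * Z θ * (Real.sin (2 * θ))⁻¹ * Real.sqrt (Real.sin (2 * θ) ^ (-η)) with hψ
    have hsq : ∀ θ ∈ Ioo (0:ℝ) (π / 2), Real.sqrt (Real.sin (2 * θ) ^ (-η)) ^ 2 = Real.sin (2 * θ) ^ (-η) := fun θ hθ =>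
      Real.sq_sqrt (Real.rpow_nonneg (hsin θ hθ).le _)
    have eJ : J = ∫ θ in Ioo 0 (π / 2), φ θ * ψ θ := setIntegral_congr_fun measurableSet_Ioo fun θ hθ => by
      have e : φ θ * ψ θ = Real.cos (2 * θ) * Z θ * deriv Z θ * (Real.sin (2 * θ))⁻¹ * Real.sqrt (Real.sin (2 * θ) ^ (-η)) ^ 2 := by
        simp only [hφ, hψ]; ring
      rw [e, hsq θ hθ]; ring
    have eX : X = ∫ θ in Ioo 0 (π / 2), φ θ ^ 2 := setIntegral_congr_fun measurableSet_Ioo fun θ hθ => by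
      simp only [hφ]; rw [mul_pow, hsq θ hθ]
    have eQ : Q = ∫ θ in Ioo 0 (π / 2), ψ θ ^ 2 := setIntegral_congr_fun measurableSet_Ioo fun θ hθ => by
      simp only [hψ]; rw [mul_pow, hsq θ hθ]; ring
    have iφ : IntegrableOn (fun θ => φ θ ^ 2) (Ioo 0 (π / 2)) :=
      iX.congr_fun (fun θ hθ => by simp only [hφ]; rw [mul_pow, hsq θ hθ]) measurableSet_Ioo
    have iψ : IntegrableOn (fun θ => ψ θ ^ 2) (Ioo 0 (π / 2)) :=
      iQ.congr_fun (fun θ hθ => by simp only [hψ]; rw [mul_pow, hsq θ hθ]; ring) measurableSet_Ioo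
    have iφψ : IntegrableOn (fun θ => φ θ * ψ θ) (Ioo 0 (π / 2)) :=
      iJ.congr_fun (fun θ hθ => by
        have e : φ θ * ψ θ = Real.cos (2 * θ) * Z θ * deriv Z θ * (Real.sin (2 * θ))⁻¹ * Real.sqrt (Real.sin (2 * θ) ^ (-η)) ^ 2 := by
          simp only [hφ, hψ]; ring
        rw [e, hsq θ hθ]; ring) measurableSet_Ioo
    rw [eJ, eX, eQ]
    exact sq_integral_mul_le (μ := volume.restrict (Ioo (0:ℝ) (π / 2))) iφ iψ iφψ
  have hX0 : 0 ≤ X := setIntegral_nonneg measurableSet_Ioo fun θ hθ => mul_nonneg (sq_nonneg _) (Real.rpow_nonneg (hsin θ hθ).le _)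
  have hP0 : 0 ≤ P := setIntegral_nonneg measurableSet_Ioo fun θ hθ => mul_nonneg (sq_nonneg _) (Real.rpow_nonneg (hsin θ hθ).le _)
  have hQ0 : 0 ≤ Q := setIntegral_nonneg measurableSet_Ioo fun θ hθ =>
    mul_nonneg (mul_nonneg (mul_nonneg (sq_nonneg _) (sq_nonneg _)) (Real.rpow_nonneg (hsin θ hθ).le _)) (sq_nonneg _)
  refine ⟨iN, ?_⟩
  have h := interp_absorb (N := -Nn) hX0 hP0 hQ0 hCS hid
  unfold wsq
  simpa [hX] using h

/-! ### The angular words of `sin 2θ·v` -/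

/-- A smooth function has a smooth primitive. [folklore] -/
theorem exists_smooth_primitive {v : ℝ → ℝ} (hv : ContDiff ℝ ∞ v) : ∃ V : ℝ → ℝ, ContDiff ℝ ∞ V ∧ deriv V = v := by
  set V : ℝ → ℝ := fun θ => ∫ t in (0:ℝ)..θ, v t with hV
  have hd : ∀ θ, HasDerivAt V (v θ) θ := fun θ => by
    simp only [hV]
    exact intervalIntegral.integral_hasDerivAt_right (hv.continuous.intervalIntegrable _ _)
      (hv.continuous.stronglyMeasurableAtFilter _ _) hv.continuous.continuousAt
  have hdv : deriv V = v := funext fun θ => (hd θ).deriv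
  have hdiff : Differentiable ℝ V := fun θ => (hd θ).differentiableAt
  refine ⟨V, contDiff_infty.2 fun n => ?_, hdv⟩
  have h : ContDiff ℝ ((n : ℕ∞) + 1 : ℕ∞) V := by
    rw [show (((n : ℕ∞) + 1 : ℕ∞) : WithTop ℕ∞) = (n : WithTop ℕ∞) + 1 by push_cast; rfl, contDiff_succ_iff_deriv]
    exact ⟨hdiff, fun h => by simp at h, by rw [hdv]; exact hv.of_le (WithTop.coe_le_coe.2 le_top)⟩
  exact h.of_le (by exact_mod_cast le_self_add)

/-- **The angular words of `sin 2θ·v`**: for smooth `v`, `1 < γ < 2` and `m ≤ 3`,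
`∫ (D_θᵐ(Sv))² S^{−γ} ≤ 4·10⁹·(Σ_{i<m} ∫ (D_θ^{i+1}v)² S^{−γ} + ∫ v² S^{−η})` (`S = sin 2θ`; indeed
`Sv = D_θV` for a primitive `V` of `v`, so these are the words of `V` of orders `≤ 4`), and the word
integrand is integrable. [folklore] -/
theorem wsq_iterate_Dθ₁_sin_mul_le {γ : ℝ} (hγ1 : 1 < γ) (hγ2 : γ < 2) {v : ℝ → ℝ} (hv : ContDiff ℝ ∞ v) {m : ℕ} (hm : m ≤ 3) :
    IntegrableOn (fun θ => (Dθ₁^[m] fun x => Real.sin (2 * x) * v x) θ ^ 2 * Real.sin (2 * θ) ^ (-γ)) (Ioo 0 (π / 2)) ∧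
    wsq (-γ) (Dθ₁^[m] fun x => Real.sin (2 * x) * v x) ≤
      4 * 10 ^ 9 * ((∑ i ∈ range m, wsq (-γ) (Dθ₁^[i + 1] v)) + wsq (-eta) v) := by
  obtain ⟨V, hVs, hdV⟩ := exists_smooth_primitive hv
  have eg : (fun x => Real.sin (2 * x) * v x) = Dθ₁ V := by
    funext x; simp only [Dθ₁, hdV]
  have eiter : (Dθ₁^[m] fun x => Real.sin (2 * x) * v x) = Dθ₁^[m + 1] V := by
    rw [eg, ← Function.iterate_succ_apply]
  rw [eiter]
  obtain ⟨iV, -⟩ := wsq_iterate_Dθ₁_le hγ2 hVs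
  refine ⟨iV (m + 1) (by omega) (by omega), ?_⟩
  have key := sum_wsq_iterate_Dθ₁_le_deriv hγ1 hγ2 hVs (n := m + 1) (by omega)
  rw [hdV, show m + 1 - 1 = m by omega] at key
  have hs : wsq (-γ) (Dθ₁^[m + 1] V) ≤ ∑ i ∈ range (m + 1), wsq (-γ) (Dθ₁^[i + 1] V) :=
    Finset.single_le_sum (f := fun i => wsq (-γ) (Dθ₁^[i + 1] V)) (fun i _ => wsq_nonneg _ _) (mem_range.2 (Nat.lt_succ_self m))
  exact hs.trans key

/-! ### The radial integration by parts -/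

/-- `D_z(w²) = −4w²/(1+z)` for `z > 0`, `w² = (1+z)⁴/z⁴`. [folklore] -/
theorem hasDerivAt_radialWeight_sq {z : ℝ} (hz : 0 < z) :
    HasDerivAt (fun x => radialWeight x ^ 2) (-(4 * radialWeight z ^ 2 / (1 + z)) / z) z := by
  have e : ∀ x, 0 < x → radialWeight x ^ 2 = (1 + x) ^ 4 / x ^ 4 := fun x _ => radialWeight_sq x
  have h1 : HasDerivAt (fun x : ℝ => (1 + x) ^ 4) (4 * (1 + z) ^ 3) z := by
    have h := (hasDerivAt_pow 4 (1 + z)).comp z ((hasDerivAt_id z).const_add 1)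
    exact h.congr_deriv (by norm_num)
  have h2 : HasDerivAt (fun x : ℝ => x ^ 4) (4 * z ^ 3) z := by simpa using hasDerivAt_pow 4 z
  have h := h1.div h2 (pow_ne_zero 4 hz.ne')
  have hev : (fun x => radialWeight x ^ 2) =ᶠ[𝓝 z] fun x => (1 + x) ^ 4 / x ^ 4 :=
    Filter.eventuallyEq_of_mem (Ioi_mem_nhds hz) fun x hx => e x hx
  refine (h.congr_of_eventuallyEq hev).congr_deriv ?_
  rw [radialWeight_sq]
  field_simp
  ring

/-- `|D_z(w²)| ≤ 4w²`: `D_z(w²) = z·(w²)′ = −4w²/(1+z)`. [folklore] -/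
theorem Dz₁_radialWeight_sq {z : ℝ} (hz : 0 < z) : Dz₁ (fun x => radialWeight x ^ 2) z = -(4 * radialWeight z ^ 2 / (1 + z)) := by
  simp only [Dz₁, (hasDerivAt_radialWeight_sq hz).deriv]
  field_simp

/-- `|D_z(w²)| ≤ 4w²` for `z > 0`. [folklore] -/
theorem abs_Dz₁_radialWeight_sq_le {z : ℝ} (hz : 0 < z) : |Dz₁ (fun x => radialWeight x ^ 2) z| ≤ 4 * radialWeight z ^ 2 := by
  rw [Dz₁_radialWeight_sq hz, abs_neg, abs_div, abs_of_nonneg (by positivity : (0:ℝ) ≤ 4 * radialWeight z ^ 2),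
    abs_of_pos (by linarith : (0:ℝ) < 1 + z), div_le_iff₀ (by linarith : (0:ℝ) < 1 + z)]
  nlinarith [sq_nonneg (radialWeight z), hz]

/-- **The radial identity**: for `a, b ∈ C^∞(ℝ)` with `a` vanishing near `0` and for large `z`,
`∫_{z>0} (D_za)(D_zb)w² = −∫_{z>0} b·(D_za + D_z²a)w² − ∫_{z>0} b·D_za·D_z(w²)` (`D_z = z∂_z`,
`w² = (1+z)⁴/z⁴`; from `∫ (z²a′w²b)′ = 0`). [folklore] -/
theorem integral_Ioi_Dz₁_mul_Dz₁_weight {a b : ℝ → ℝ} (ha : ContDiff ℝ ∞ a) (hb : ContDiff ℝ ∞ b)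
    {z₁ z₂ : ℝ} (hz₁ : 0 < z₁) (ha₁ : ∀ z < z₁, a z = 0) (ha₂ : ∀ z, z₂ < z → a z = 0) :
    ∫ z in Ioi (0:ℝ), Dz₁ a z * Dz₁ b z * radialWeight z ^ 2 =
      -(∫ z in Ioi (0:ℝ), b z * (Dz₁ a z + Dz₁ (Dz₁ a) z) * radialWeight z ^ 2) -
        ∫ z in Ioi (0:ℝ), b z * Dz₁ a z * Dz₁ (fun x => radialWeight x ^ 2) z := by
  -- notation and regularity
  set W : ℝ → ℝ := fun x => radialWeight x ^ 2 with hW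
  have hWs : ContDiffOn ℝ ∞ W (Ioi 0) := by
    have : ContDiffOn ℝ ∞ (fun x : ℝ => (1 + x) ^ 4 / x ^ 4) (Ioi 0) :=
      (by fun_prop : ContDiff ℝ ∞ fun x : ℝ => (1 + x) ^ 4).contDiffOn.div (by fun_prop) fun x hx => pow_ne_zero 4 (ne_of_gt hx)
    exact this.congr fun x _ => radialWeight_sq x
  have hda : ContDiff ℝ ∞ (deriv a) := ha.deriv'
  have hdda : ContDiff ℝ ∞ (deriv (deriv a)) := hda.deriv'
  have hdb : ContDiff ℝ ∞ (deriv b) := hb.deriv'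
  have had : ∀ z, HasDerivAt a (deriv a z) z := fun z => ((ha.differentiable (by simp)) z).hasDerivAt
  have hdad : ∀ z, HasDerivAt (deriv a) (deriv (deriv a) z) z := fun z => ((hda.differentiable (by simp)) z).hasDerivAt
  have hbd : ∀ z, HasDerivAt b (deriv b z) z := fun z => ((hb.differentiable (by simp)) z).hasDerivAt
  -- `a′` vanishes near `0` and for large `z`
  have hda₁ : ∀ z < z₁, deriv a z = 0 := fun z hz => by
    have : a =ᶠ[𝓝 z] fun _ => 0 := Filter.eventuallyEq_of_mem (Iio_mem_nhds hz) fun y hy => ha₁ y hy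
    rw [this.deriv_eq, deriv_const]
  have hda₂ : ∀ z, z₂ < z → deriv a z = 0 := fun z hz => by
    have : a =ᶠ[𝓝 z] fun _ => 0 := Filter.eventuallyEq_of_mem (Ioi_mem_nhds hz) fun y hy => ha₂ y hy
    rw [this.deriv_eq, deriv_const]
  have hdda₁ : ∀ z < z₁, deriv (deriv a) z = 0 := fun z hz => by
    have : deriv a =ᶠ[𝓝 z] fun _ => 0 := Filter.eventuallyEq_of_mem (Iio_mem_nhds hz) fun y hy => hda₁ y hy
    rw [this.deriv_eq, deriv_const]
  have hDa : ContDiff ℝ ∞ (Dz₁ a) := contDiff_id.mul hda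
  have hDDa : ContDiff ℝ ∞ (Dz₁ (Dz₁ a)) := contDiff_id.mul hDa.deriv'
  have hDb : ContDiff ℝ ∞ (Dz₁ b) := contDiff_id.mul hdb
  have hDa₁ : ∀ z < z₁, Dz₁ a z = 0 := fun z hz => by simp [Dz₁, hda₁ z hz]
  have hDa₂ : ∀ z, z₂ < z → Dz₁ a z = 0 := fun z hz => by simp [Dz₁, hda₂ z hz]
  have hDDa₁ : ∀ z < z₁, Dz₁ (Dz₁ a) z = 0 := fun z hz => by
    have : Dz₁ a =ᶠ[𝓝 z] fun _ => 0 := Filter.eventuallyEq_of_mem (Iio_mem_nhds hz) fun y hy => hDa₁ y hy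
    simp only [Dz₁]; rw [this.deriv_eq, deriv_const, mul_zero]
  have hDDa₂ : ∀ z, z₂ < z → Dz₁ (Dz₁ a) z = 0 := fun z hz => by
    have : Dz₁ a =ᶠ[𝓝 z] fun _ => 0 := Filter.eventuallyEq_of_mem (Ioi_mem_nhds hz) fun y hy => hDa₂ y hy
    simp only [Dz₁]; rw [this.deriv_eq, deriv_const, mul_zero]
  -- the boundary function `F = (z²·a′·b)·W`
  set g : ℝ → ℝ := fun z => z ^ 2 * deriv a z * b z with hg
  have hgs : ContDiff ℝ ∞ g := ((contDiff_id.pow 2).mul hda).mul hb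
  have hg₁ : ∀ z < z₁, g z = 0 := fun z hz => by simp [hg, hda₁ z hz]
  have hF : ContDiff ℝ 1 fun z => W z * g z := contDiff_weight_mul (hWs.of_le (by exact_mod_cast le_top)) (hgs.of_le (by exact_mod_cast le_top)) hz₁ hg₁
  have hFs : HasCompactSupport fun z => W z * g z := by
    refine HasCompactSupport.intro (isCompact_Icc (a := z₁) (b := z₂)) fun z hz => ?_
    rcases not_and_or.1 (fun h => hz ⟨h.1, h.2⟩ : ¬(z₁ ≤ z ∧ z ≤ z₂)) with h | h
    · simp [hg, hda₁ z (not_le.1 h)]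
    · simp [hg, hda₂ z (not_le.1 h)]
  have h0 := integral_deriv_eq_zero_of_hasCompactSupport hF hFs
  -- the derivative of the boundary function on `(0, ∞)` and below `z₁`
  have hF' : ∀ z, deriv (fun z => W z * g z) z =
      (Dz₁ a z * Dz₁ b z * W z + b z * (Dz₁ a z + Dz₁ (Dz₁ a) z) * W z) + b z * Dz₁ a z * Dz₁ W z := by
    intro z
    rcases lt_or_ge z z₁ with hz | hz
    · have : (fun z => W z * g z) =ᶠ[𝓝 z] fun _ => 0 :=
        Filter.eventuallyEq_of_mem (Iio_mem_nhds hz) fun y hy => by simp [hg₁ y hy]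
      rw [this.deriv_eq, deriv_const, hDa₁ z hz, hDDa₁ z hz]
      ring
    · have hz0 : 0 < z := lt_of_lt_of_le hz₁ hz
      have hWd : HasDerivAt W (deriv W z) z := (hWs.differentiableOn (by simp) |>.differentiableAt (Ioi_mem_nhds hz0)).hasDerivAt
      have hgd : HasDerivAt g (2 * z * deriv a z * b z + z ^ 2 * deriv (deriv a) z * b z + z ^ 2 * deriv a z * deriv b z) z := by
        have h1 : HasDerivAt (fun x : ℝ => x ^ 2) (2 * z) z := by simpa using hasDerivAt_pow 2 z
        have h2 : HasDerivAt (fun x : ℝ => x ^ 2 * deriv a x) (2 * z * deriv a z + z ^ 2 * deriv (deriv a) z) z := h1.mul (hdad z)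
        have h3 : HasDerivAt (fun x : ℝ => x ^ 2 * deriv a x * b x)
            ((2 * z * deriv a z + z ^ 2 * deriv (deriv a) z) * b z + z ^ 2 * deriv a z * deriv b z) z := h2.mul (hbd z)
        exact h3.congr_deriv (by ring)
      have hmul : HasDerivAt (fun x => W x * g x)
          (deriv W z * g z + W z * (2 * z * deriv a z * b z + z ^ 2 * deriv (deriv a) z * b z + z ^ 2 * deriv a z * deriv b z)) z :=
        hWd.mul hgd
      rw [hmul.deriv]
      have eDD : Dz₁ (Dz₁ a) z = z * deriv a z + z ^ 2 * deriv (deriv a) z := by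
        have hD : HasDerivAt (fun x => x * deriv a x) (1 * deriv a z + z * deriv (deriv a) z) z := (hasDerivAt_id z).mul (hdad z)
        have e1 : Dz₁ (Dz₁ a) z = z * deriv (fun x => x * deriv a x) z := rfl
        rw [e1, hD.deriv]; ring
      have eD : ∀ (h : ℝ → ℝ), Dz₁ h z = z * deriv h z := fun h => rfl
      rw [eDD, eD a, eD b, eD W]
      simp only [hg]
      ring
  simp_rw [hF'] at h0
  -- restrict to `(0, ∞)`: all integrands vanish for `z ≤ 0`
  have hz0 : ∀ z, z ∉ Ioi (0:ℝ) → z < z₁ := fun z hz => lt_of_le_of_lt (not_lt.1 hz) hz₁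
  have v1 : ∀ z, z ∉ Ioi (0:ℝ) → Dz₁ a z * Dz₁ b z * W z = 0 := fun z hz => by simp [Dz₁, hda₁ z (hz0 z hz)]
  have v2 : ∀ z, z ∉ Ioi (0:ℝ) → b z * (Dz₁ a z + Dz₁ (Dz₁ a) z) * W z = 0 := fun z hz => by
    rw [hDa₁ z (hz0 z hz), hDDa₁ z (hz0 z hz)]; ring
  have v3 : ∀ z, z ∉ Ioi (0:ℝ) → b z * Dz₁ a z * Dz₁ W z = 0 := fun z hz => by simp [Dz₁, hda₁ z (hz0 z hz)]
  rw [setIntegral_eq_integral_of_forall_compl_eq_zero v1, setIntegral_eq_integral_of_forall_compl_eq_zero v2,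
    setIntegral_eq_integral_of_forall_compl_eq_zero v3]
  -- integrability on `ℝ`: continuous with compact support
  have cW1 : ∀ {h : ℝ → ℝ}, ContDiff ℝ ∞ h → (∀ z < z₁, h z = 0) → Continuous fun z => W z * h z := fun hh hh₁ =>
    (contDiff_weight_mul (n := 0) (hWs.of_le (by simp)) (hh.of_le (by simp)) hz₁ hh₁).continuous
  have hDW : ContDiffOn ℝ ∞ (Dz₁ W) (Ioi 0) := by
    have h1 : ContDiffOn ℝ ∞ (deriv W) (Ioi 0) := hWs.deriv_of_isOpen isOpen_Ioi (by simp)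
    exact (contDiffOn_id.mul h1).congr fun z _ => rfl
  have cW2 : ∀ {h : ℝ → ℝ}, ContDiff ℝ ∞ h → (∀ z < z₁, h z = 0) → Continuous fun z => Dz₁ W z * h z := fun hh hh₁ =>
    (contDiff_weight_mul (n := 0) (hDW.of_le (by simp)) (hh.of_le (by simp)) hz₁ hh₁).continuous
  have supp : ∀ {h : ℝ → ℝ}, (∀ z < z₁, h z = 0) → (∀ z, z₂ < z → h z = 0) → HasCompactSupport h := fun hh₁ hh₂ => by
    refine HasCompactSupport.intro (isCompact_Icc (a := z₁) (b := z₂)) fun z hz => ?_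
    rcases not_and_or.1 (fun h => hz ⟨h.1, h.2⟩ : ¬(z₁ ≤ z ∧ z ≤ z₂)) with h | h
    · exact hh₁ z (not_le.1 h)
    · exact hh₂ z (not_le.1 h)
  have i1 : Integrable fun z => Dz₁ a z * Dz₁ b z * W z := by
    have hc : Continuous fun z => W z * (Dz₁ a z * Dz₁ b z) := cW1 (hDa.mul hDb) fun z hz => by simp [hDa₁ z hz]
    have hs : HasCompactSupport fun z => W z * (Dz₁ a z * Dz₁ b z) :=
      (supp (h := fun z => Dz₁ a z * Dz₁ b z) (fun z hz => by simp [hDa₁ z hz]) (fun z hz => by simp [hDa₂ z hz])).mul_left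
    exact (hc.integrable_of_hasCompactSupport hs).congr (ae_of_all _ fun z => by ring)
  have i2 : Integrable fun z => b z * (Dz₁ a z + Dz₁ (Dz₁ a) z) * W z := by
    have hc : Continuous fun z => W z * (b z * (Dz₁ a z + Dz₁ (Dz₁ a) z)) := cW1 (hb.mul (hDa.add hDDa)) fun z hz => by simp [hDa₁ z hz, hDDa₁ z hz]
    have hs : HasCompactSupport fun z => W z * (b z * (Dz₁ a z + Dz₁ (Dz₁ a) z)) :=
      (supp (h := fun z => b z * (Dz₁ a z + Dz₁ (Dz₁ a) z)) (fun z hz => by simp [hDa₁ z hz, hDDa₁ z hz]) (fun z hz => by simp [hDa₂ z hz, hDDa₂ z hz])).mul_left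
    exact (hc.integrable_of_hasCompactSupport hs).congr (ae_of_all _ fun z => by ring)
  have i3 : Integrable fun z => b z * Dz₁ a z * Dz₁ W z := by
    have hc : Continuous fun z => Dz₁ W z * (b z * Dz₁ a z) := cW2 (hb.mul hDa) fun z hz => by simp [hDa₁ z hz]
    have hs : HasCompactSupport fun z => Dz₁ W z * (b z * Dz₁ a z) :=
      (supp (h := fun z => b z * Dz₁ a z) (fun z hz => by simp [hDa₁ z hz]) (fun z hz => by simp [hDa₂ z hz])).mul_left
    exact (hc.integrable_of_hasCompactSupport hs).congr (ae_of_all _ fun z => by ring)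
  have i12 : Integrable fun z => Dz₁ a z * Dz₁ b z * W z + b z * (Dz₁ a z + Dz₁ (Dz₁ a) z) * W z := i1.add i2
  rw [MeasureTheory.integral_add i12 i3, MeasureTheory.integral_add i1 i2] at h0
  linarith


end Elgindi

end Literature.Analysis.FluidPDE
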